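import Literature.MathematicalPhysics.QuantumFieldTheory.Balaban1983to89.B6KLevelCensusIndexV1
import Literature.MathematicalPhysics.QuantumFieldTheory.Balaban1983to89.B6RandomWalkInputNorm

/-!
# `Balaban1983to89.B6HolderNormV1` — T. Bałaban, *Propagators and renormalization transformations for lattice gauge theories. II*,
# Commun. Math. Phys. **96** (1984) 223–250 [Balaban1984PropagatorsII], Prop. 2.6 (2.138) p. 247 with [Balaban1984PropagatorsI] (1.109) p. 35:
# THE INPUT HÖLDER DATA `‖J‖^{ξ′}_ε + |J|` OF (2.138) FOR RAW V1 TORUS DATA — r03's census functionals `(kGeoG i).holder ε`, `(kGeoG i).supNorm`,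
# `Adm i`, `tpar i` of `…B6KLevelCensusIndexV1` with the index `i : KIdx` replaced by a raw torus datum `(hN, D)`, `rfl`-bridged, and the
# admissible-input class `NormSupp (blkV1 hN D) {y′} (‖·‖_ε + |·|)` of `…B6RandomWalkInputNorm` they define

statement-level skeleton of published theorems with citation tags; proofs where landed; nothing here is a claim about the Yang–Mills mass gap

PDF held: `paper:balaban1984-cmp96-propagators-rt-ii` (journal page = PDF page + 222), p. 247 [PDF 25]: *"|(∇G∇*J)(x)| ≤ O(1)e^{−δ₃d(y,y′)}(‖J‖^{ξ′}_ε
+ |J|) (2.138) for 0 < ε < 1, x ∈ Δ(y), supp J ⊂ Δ̃(y′), y′ ∈ Λ_{j′}, ξ′ = L^{−j′}"* (the tree's census consumer reads the sub-case `supp J ⊂ Δ(y′)`,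
see `normSupp_of_suppIn`); [Balaban1984PropagatorsI] (1.109) p. 35: the Hölder quotient
`|x − x′|^{−α}|A(x) − A(x′)|` over pairs `|x − x′| ≤ 1` at the scale `ξ`.

CITATION HEADER (lean-in-tree rule) — WHAT IS REPRODUCED.  Phase-2 file of the `lit-balaban` typed skeleton (HOME `run/shared/lean/pub/lit-balaban/`), seat
**p27 gen 90** (TAKING HOME/STATUS 2026-08-24T22:31Z on p38 g34's named offer = `HOME/lit-balaban-p27/WAKE-2138-legs.md`; extra stem TAKING 2026-08-25;
B6 fold owner r03); SKELETON rows B6.Eq2.138 × B6.Prop2.6 (cells only; decls of record untouched).  The per-cube legs of (2.138) at k levels are stated,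
like r03's `…B6CubeInDecayV1.hGin_cube` and p38's `…B6GradLegKLevelV1.hDG0_cube`, for a RAW torus datum (`hN`, `D : TDomains`, a cube, weights, the
fine factor `c′`), while the census functionals of the consumer `B6.Prop26Printed` are fields of r03's `kGeoG i` for an index record `i : KIdx`.
THIS FILE declares the same functionals for raw data and bridges them:
* §1 `AdmV1 hN D` (admissible ordered pairs of fine bonds: same direction, `|x − x′|_∞ ≤ L^{j(y(x))}` and `≤ L^{j(y(x′))}`), `tparV1 hN D`
  (`t = |x − x′|_∞/L^{j(y(x))}`), with `admV1_symm`, `tparV1_nonneg`, `tparV1_le_one`, `tparV1_pos`;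
* §2 `supNormV1 J = sup|J(x)|`, `holderV1 hN D ε J = sup over admissible pairs of t^{−ε}|J(x) − J(x′)|`, with the `le`/`nonneg`/intro API;
* §3 THE BRIDGE `adm_iff`, `tpar_eq`, `kGeoG_supNorm_eq`, `kGeoG_holder_eq` (all definitional) and the census class: r03's hypothesis
  `(kGeoG i).suppIn J y′` («supp J ⊂ Δ(y′)») IS membership in `NormSupp (blkV1) (fun y′ ↦ {y′}) (fun _ J ↦ holderV1 ε J + supNormV1 J)` with the size
  `‖J‖_ε + |J|` (`normSupp_of_suppIn`), so a `HasMajorantA` for that class reads as the printed display (`abs_apply_le_of_suppIn`);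
* §4 MULTIPLIERS: `‖χJ‖_ε ≤ ‖J‖_ε + Λ|J|` for `|χ| ≤ 1` and `χ` `Λ`-Lipschitz at the block scale on admissible pairs (`holderV1_mulOp_le`), hence
  `mulOp χ` maps the class at `y′` of size `B` into the class at `y′` of size `(1 + Λ)B` (`normSupp_mulOp`) — the input `(S_νh_□)J` of the `n = 0`
  legs `∇_μ(h_□G_□h_□)∇*_ν` of (2.141).
DEFINITIONS WITH BODIES (`AdmV1`, `tparV1`, `supNormV1`, `holderV1`) + THEOREMS; no `def … : Prop` fact; standard axioms.

HONEST SCOPE.  Bookkeeping only: no inequality of print is claimed; `…B6KLevelCensusIndexV1` is untouched (its `Adm`/`tpar`/`kGeoG` remain the census's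
vocabulary; the raw-data copies here are equal to them by `rfl`).  NOT summit progress.  Unit `lit-balaban-p27` (gen 90), 2026-08-25.
-/

noncomputable section

namespace Literature.MathematicalPhysics.QuantumFieldTheory.Balaban1983to89.B6HolderNormV1

open LatticeFieldCalculus
open B6MultiLevelBoxOperator (N0)
open B6MultiLevelTorusOperator (TDomains)
open B6GlobalChartV1 (PV blkV1)
open B6Geom246MultiLevelTorus (geomT)
open B6RandomWalkInputNorm (HasMajorantA NormSupp)
open B6Prop26Gluing (mulOp mulOp_apply)
open B6KLevelCensusIndexV1 (KIdx Adm tpar kGeoG)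
open B3TorusRadialSums (supDist_comm supDist_eq_zero_iff)

variable {d ℓ : ℕ} {hd : 1 ≤ d + 1} {hL : Odd (ℓ + 1) ∧ 1 < ℓ + 1} {m K : ℕ} {Mh k R : ℕ} {P' : Fin (d + 1) → ℕ}
variable (hN : ∀ μ, N0 ℓ Mh k P' μ = (PV d ℓ m K hd hL).sitesPerDir 0) (D : TDomains d ℓ Mh k P' R)

/-! ## §1  Admissible ordered pairs of fine bonds and the pair parameter, for a raw torus datum -/

/-- **ADMISSIBLE ordered pairs of fine bonds** for the raw datum `(hN, D)` (r03's `…B6KLevelCensusIndexV1.Adm i` with `i.hN, i.D ↦ hN, D`): same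
direction, `|x − x′|_∞ ≤ L^{j(y(x))}` and `|x − x′|_∞ ≤ L^{j(y(x′))}` (print's «x, x′ ∈ Δ̃(y)», the quotient over pairs `|x − x′| ≤ ξ`).
[cite: Balaban1984PropagatorsII, (2.137)–(2.138) p.247; Balaban1984PropagatorsI, (1.109) p.35 (reading p22/r03)] -/
def AdmV1 (x x' : PBond (PV d ℓ m K hd hL) 0) : Prop :=
  x.dir = x'.dir ∧ supDist x.src x'.src ≤ (ℓ + 1) ^ (blkV1 hN D x).1.1 ∧ supDist x.src x'.src ≤ (ℓ + 1) ^ (blkV1 hN D x').1.1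

/-- admissibility is decidable. [cite: Balaban1984PropagatorsII, (2.137) p.247 (reading p22/r03), bookkeeping] -/
instance (x x' : PBond (PV d ℓ m K hd hL) 0) : Decidable (AdmV1 hN D x x') := by
  unfold AdmV1; exact inferInstance

/-- admissibility is symmetric. [cite: Balaban1984PropagatorsII, (2.137) p.247 (reading p22/r03), bookkeeping] -/
theorem admV1_symm {x x' : PBond (PV d ℓ m K hd hL) 0} (h : AdmV1 hN D x x') : AdmV1 hN D x' x := by
  obtain ⟨h1, h2, h3⟩ := h
  exact ⟨h1.symm, by rwa [supDist_comm], by rwa [supDist_comm]⟩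

/-- **the pair parameter `t = |x − x′|_∞/L^{j(y(x))}`** for the raw datum (r03's `tpar i`). [cite: Balaban1984PropagatorsII, (2.137)–(2.138) p.247 (reading p22/r03)] -/
def tparV1 (x x' : PBond (PV d ℓ m K hd hL) 0) : ℝ :=
  ((supDist x.src x'.src : ℕ) : ℝ) / (((ℓ + 1 : ℕ) : ℝ)) ^ (blkV1 hN D x).1.1

/-- `0 ≤ t`. [cite: Balaban1984PropagatorsII, (2.137) p.247, bookkeeping] -/
theorem tparV1_nonneg (x x' : PBond (PV d ℓ m K hd hL) 0) : 0 ≤ tparV1 hN D x x' := by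
  unfold tparV1; positivity

/-- `t ≤ 1` on an admissible pair. [cite: Balaban1984PropagatorsII, (2.137) p.247; Balaban1984PropagatorsI, (1.109) p.35] -/
theorem tparV1_le_one {x x' : PBond (PV d ℓ m K hd hL) 0} (h : AdmV1 hN D x x') : tparV1 hN D x x' ≤ 1 := by
  unfold tparV1
  have hpos : (0 : ℝ) < (((ℓ + 1 : ℕ) : ℝ)) ^ (blkV1 hN D x).1.1 := by positivity
  rw [div_le_one hpos]
  exact_mod_cast h.2.1

/-- `t > 0` when the initial points differ. [cite: Balaban1984PropagatorsII, (2.137) p.247, bookkeeping] -/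
theorem tparV1_pos {x x' : PBond (PV d ℓ m K hd hL) 0} (h : x.src ≠ x'.src) : 0 < tparV1 hN D x x' := by
  unfold tparV1
  have h1 : supDist x.src x'.src ≠ 0 := fun h0 => h ((supDist_eq_zero_iff _ _).1 h0)
  have h2 : (0 : ℝ) < ((supDist x.src x'.src : ℕ) : ℝ) := by exact_mod_cast Nat.pos_of_ne_zero h1
  positivity

/-- `t ≤ |x − x′|_∞/L^{j}` whenever `j ≤ j(y(x))` (the member's quotient at the scale `L^{j₀}` of its torus dominates the census parameter on the
window, whose blocks have level `≥ j₀`). [cite: Balaban1984PropagatorsII, (2.2) p.224 + (2.138) p.247, bookkeeping] -/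
theorem tparV1_le_div {x x' : PBond (PV d ℓ m K hd hL) 0} {j : ℕ} (hj : j ≤ (blkV1 hN D x).1.1) :
    tparV1 hN D x x' ≤ ((supDist x.src x'.src : ℕ) : ℝ) / (((ℓ + 1 : ℕ) : ℝ)) ^ j := by
  unfold tparV1
  have hL1 : (1 : ℝ) ≤ ((ℓ + 1 : ℕ) : ℝ) := by exact_mod_cast Nat.succ_pos ℓ
  exact div_le_div_of_nonneg_left (Nat.cast_nonneg _) (by positivity) (pow_le_pow_right₀ hL1 hj)

/-! ## §2  The sup norm and the Hölder functional of a fine bond field -/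

/-- **`|J| = sup_x |J(x)|`** (r03's `(kGeoG i).supNorm`). [cite: Balaban1984PropagatorsII, p.231 («|λ| = sup|λ(x)|»), (2.138) p.247] -/
def supNormV1 (J : PBond (PV d ℓ m K hd hL) 0 → ℝ) : ℝ := ⨆ x, |J x|

/-- **`‖J‖^{ξ′}_ε`** = the sup over admissible ordered pairs of `t^{−ε}|J(x) − J(x′)|` (r03's `(kGeoG i).holder ε`).
[cite: Balaban1984PropagatorsII, (2.138) p.247 («‖J‖^{ξ′}_ε, ξ′ = L^{−j′}»); Balaban1984PropagatorsI, (1.109) p.35] -/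
def holderV1 (ε : ℝ) (J : PBond (PV d ℓ m K hd hL) 0 → ℝ) : ℝ :=
  ⨆ q : PBond (PV d ℓ m K hd hL) 0 × PBond (PV d ℓ m K hd hL) 0,
    if AdmV1 hN D q.1 q.2 then tparV1 hN D q.1 q.2 ^ (-ε) * |J q.1 - J q.2| else 0

/-- `|J(x)| ≤ |J|`. [cite: Balaban1984PropagatorsII, p.231, bookkeeping] -/
theorem abs_le_supNormV1 (J : PBond (PV d ℓ m K hd hL) 0 → ℝ) (x : PBond (PV d ℓ m K hd hL) 0) : |J x| ≤ supNormV1 J :=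
  le_ciSup (f := fun x => |J x|) (Set.finite_range _).bddAbove x

/-- `0 ≤ |J|`. [cite: Balaban1984PropagatorsII, p.231, bookkeeping] -/
theorem supNormV1_nonneg (J : PBond (PV d ℓ m K hd hL) 0 → ℝ) : 0 ≤ supNormV1 J :=
  Real.iSup_nonneg fun _ => abs_nonneg _

/-- `|J| ≤ C` from a pointwise bound (`C ≥ 0`). [cite: Balaban1984PropagatorsII, p.231, bookkeeping] -/
theorem supNormV1_le {J : PBond (PV d ℓ m K hd hL) 0 → ℝ} {C : ℝ} (hC : 0 ≤ C) (h : ∀ x, |J x| ≤ C) : supNormV1 J ≤ C :=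
  Real.iSup_le h hC

/-- the admissible pair terms are bounded by `‖J‖_ε`. [cite: Balaban1984PropagatorsII, (2.138) p.247; Balaban1984PropagatorsI, (1.109) p.35] -/
theorem le_holderV1 (ε : ℝ) (J : PBond (PV d ℓ m K hd hL) 0 → ℝ) {x x' : PBond (PV d ℓ m K hd hL) 0} (h : AdmV1 hN D x x') :
    tparV1 hN D x x' ^ (-ε) * |J x - J x'| ≤ holderV1 hN D ε J := by
  have h1 := le_ciSup (f := fun q : PBond (PV d ℓ m K hd hL) 0 × PBond (PV d ℓ m K hd hL) 0 =>
    if AdmV1 hN D q.1 q.2 then tparV1 hN D q.1 q.2 ^ (-ε) * |J q.1 - J q.2| else 0) (Set.finite_range _).bddAbove (x, x')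
  simp only [if_pos h] at h1
  exact h1

/-- `0 ≤ ‖J‖_ε`. [cite: Balaban1984PropagatorsII, (2.138) p.247, bookkeeping] -/
theorem holderV1_nonneg (ε : ℝ) (J : PBond (PV d ℓ m K hd hL) 0 → ℝ) : 0 ≤ holderV1 hN D ε J :=
  Real.iSup_nonneg fun q => by
    by_cases hq : AdmV1 hN D q.1 q.2
    · rw [if_pos hq]; exact mul_nonneg (Real.rpow_nonneg (tparV1_nonneg hN D _ _) _) (abs_nonneg _)
    · rw [if_neg hq]

/-- `‖J‖_ε ≤ C` from a bound on the admissible pair terms (`C ≥ 0`). [cite: Balaban1984PropagatorsII, (2.138) p.247, bookkeeping] -/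
theorem holderV1_le {ε : ℝ} {J : PBond (PV d ℓ m K hd hL) 0 → ℝ} {C : ℝ} (hC : 0 ≤ C)
    (h : ∀ x x', AdmV1 hN D x x' → tparV1 hN D x x' ^ (-ε) * |J x - J x'| ≤ C) : holderV1 hN D ε J ≤ C :=
  Real.iSup_le (fun q => by
    by_cases hq : AdmV1 hN D q.1 q.2
    · rw [if_pos hq]; exact h _ _ hq
    · rw [if_neg hq]; exact hC) hC

/-! ## §3  The bridge to the census index `KIdx` and the admissible-input class of (2.138) -/

section Bridge

variable {b₀ b₁ : ℝ}

/-- `Adm i` IS `AdmV1 i.hN i.D`. [cite: Balaban1984PropagatorsII, (2.137) p.247, dictionary] -/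
theorem adm_iff (i : KIdx d ℓ hd hL b₀ b₁) (x x' : PBond (PV d ℓ i.m i.K hd hL) 0) : Adm i x x' ↔ AdmV1 i.hN i.D x x' := Iff.rfl

/-- `tpar i` IS `tparV1 i.hN i.D`. [cite: Balaban1984PropagatorsII, (2.137) p.247, dictionary] -/
theorem tpar_eq (i : KIdx d ℓ hd hL b₀ b₁) (x x' : PBond (PV d ℓ i.m i.K hd hL) 0) : tpar i x x' = tparV1 i.hN i.D x x' := rfl

/-- `(kGeoG i).supNorm` IS `supNormV1`. [cite: Balaban1984PropagatorsII, p.231, dictionary] -/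
theorem kGeoG_supNorm_eq (i : KIdx d ℓ hd hL b₀ b₁) (J : PBond (PV d ℓ i.m i.K hd hL) 0 → ℝ) : (kGeoG i).supNorm J = supNormV1 J := rfl

/-- `(kGeoG i).holder ε` IS `holderV1 i.hN i.D ε`. [cite: Balaban1984PropagatorsII, (2.138) p.247, dictionary] -/
theorem kGeoG_holder_eq (i : KIdx d ℓ hd hL b₀ b₁) (ε : ℝ) (J : PBond (PV d ℓ i.m i.K hd hL) 0 → ℝ) :
    (kGeoG i).holder ε J = holderV1 i.hN i.D ε J := rfl

/-- **«supp J ⊂ Δ(y′)» WITH THE SIZE `‖J‖_ε + |J|` IS MEMBERSHIP IN THE ADMISSIBLE-INPUT CLASS OF (2.138)**: r03's census hypothesis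
`(kGeoG i).suppIn J y′` gives `NormSupp (blkV1) (fun y′ ↦ {y′}) (fun _ J ↦ holderV1 ε J + supNormV1 J) J y′ (‖J‖_ε + |J|)`.
[cite: Balaban1984PropagatorsII, (2.138) p.247 («supp J ⊂ Δ(y′)», «(‖J‖^{ξ′}_ε + |J|)»)] -/
theorem normSupp_of_suppIn (i : KIdx d ℓ hd hL b₀ b₁) (ε : ℝ) {J : PBond (PV d ℓ i.m i.K hd hL) 0 → ℝ} {y' : (geomT i.D).Site}
    (h : (kGeoG i).suppIn J y') :
    NormSupp (g := geomT i.D) (blkV1 i.hN i.D) (fun y' => ({y'} : Set (geomT i.D).Site))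
      (fun _ J => holderV1 i.hN i.D ε J + supNormV1 J) J y' ((kGeoG i).holder ε J + (kGeoG i).supNorm J) := by
  refine ⟨?_, ?_, fun x hx => ?_⟩
  · rw [kGeoG_holder_eq, kGeoG_supNorm_eq]
    exact add_nonneg (holderV1_nonneg _ _ ε J) (supNormV1_nonneg J)
  · rw [kGeoG_holder_eq, kGeoG_supNorm_eq]
  · by_contra hJ
    exact hx (Set.mem_singleton_iff.2 (h x hJ))

/-- **THE READING OF (2.138) ON THE CENSUS**: a `HasMajorantA` for the class gives, for every `J` with «supp J ⊂ Δ(y′)» and every output bond `x`,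
`|(TJ)(x)| ≤ K(y(x), y′)·(‖J‖_ε + |J|)` in r03's functionals. [cite: Balaban1984PropagatorsII, (2.138) p.247] -/
theorem abs_apply_le_of_suppIn (i : KIdx d ℓ hd hL b₀ b₁) (ε : ℝ) {T : Module.End ℝ (PBond (PV d ℓ i.m i.K hd hL) 0 → ℝ)}
    {K' : (geomT i.D).Site → (geomT i.D).Site → ℝ}
    (hT : HasMajorantA (g := geomT i.D) (blkV1 i.hN i.D)
      (NormSupp (g := geomT i.D) (blkV1 i.hN i.D) (fun y' => ({y'} : Set (geomT i.D).Site)) (fun _ J => holderV1 i.hN i.D ε J + supNormV1 J)) T K')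
    {J : PBond (PV d ℓ i.m i.K hd hL) 0 → ℝ} {y' : (geomT i.D).Site} (h : (kGeoG i).suppIn J y') (x : PBond (PV d ℓ i.m i.K hd hL) 0) :
    |T J x| ≤ K' (blkV1 i.hN i.D x) y' * ((kGeoG i).holder ε J + (kGeoG i).supNorm J) :=
  hT y' J _ (normSupp_of_suppIn i ε h) x

end Bridge

/-! ## §4  Multipliers: `‖χJ‖_ε ≤ ‖J‖_ε + Λ|J|` and the class map of `mulOp χ` -/

section Mul

variable {hN D}

/-- `t^{−ε}·(Λt) ≤ Λ` for `0 ≤ t ≤ 1`, `ε ≤ 1`, `Λ ≥ 0`. [folklore] -/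
private theorem rpow_neg_mul_le {t ε Λ : ℝ} (ht0 : 0 ≤ t) (ht1 : t ≤ 1) (hε1 : ε ≤ 1) (hΛ : 0 ≤ Λ) :
    t ^ (-ε) * (Λ * t) ≤ Λ := by
  rcases ht0.eq_or_lt with h | h
  · rw [← h, mul_zero, mul_zero]; exact hΛ
  · have h1 : t ^ (-ε) * t = t ^ (1 - ε) := by
      rw [show (1 : ℝ) - ε = -ε + 1 by ring, Real.rpow_add h, Real.rpow_one]
    have h2 : t ^ (1 - ε) ≤ 1 := Real.rpow_le_one ht0 ht1 (by linarith)
    calc t ^ (-ε) * (Λ * t) = Λ * (t ^ (-ε) * t) := by ring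
      _ ≤ Λ * 1 := by rw [h1]; exact mul_le_mul_of_nonneg_left h2 hΛ
      _ = Λ := mul_one Λ

/-- **THE PRODUCT RULE FOR THE HÖLDER FUNCTIONAL**: for a multiplier `χ` with `|χ| ≤ 1` which is `Λ`-Lipschitz at the block scale on admissible pairs
(`|χ(x) − χ(x′)| ≤ Λ·t(x, x′)`), `‖χJ‖_ε ≤ ‖J‖_ε + Λ|J|` (`ε ≤ 1`). [cite: Balaban1984PropagatorsII, (2.138)/(2.141) p.247 (the inputs `h_□J` of the
legs); Balaban1984PropagatorsI, (1.109) p.35; derivation ours] -/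
theorem holderV1_mulOp_le {ε : ℝ} (hε1 : ε ≤ 1) {χ : PBond (PV d ℓ m K hd hL) 0 → ℝ} {Λ : ℝ} (hΛ : 0 ≤ Λ)
    (hχ1 : ∀ x, |χ x| ≤ 1) (hχL : ∀ x x', AdmV1 hN D x x' → |χ x - χ x'| ≤ Λ * tparV1 hN D x x')
    (J : PBond (PV d ℓ m K hd hL) 0 → ℝ) :
    holderV1 hN D ε (mulOp χ J) ≤ holderV1 hN D ε J + Λ * supNormV1 J := by
  have hS := supNormV1_nonneg J
  have hH := holderV1_nonneg hN D ε J
  refine holderV1_le hN D (by positivity) fun x x' hq => ?_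
  have ht0 := tparV1_nonneg hN D x x'
  have ht1 := tparV1_le_one hN D hq
  have hpow : 0 ≤ tparV1 hN D x x' ^ (-ε) := Real.rpow_nonneg ht0 _
  rw [mulOp_apply, mulOp_apply]
  -- `χ(x)J(x) − χ(x′)J(x′) = χ(x)(J(x) − J(x′)) + (χ(x) − χ(x′))J(x′)`
  have hsplit : |χ x * J x - χ x' * J x'| ≤ |J x - J x'| + Λ * tparV1 hN D x x' * supNormV1 J := by
    have e : χ x * J x - χ x' * J x' = χ x * (J x - J x') + (χ x - χ x') * J x' := by ring
    rw [e]
    refine (abs_add_le _ _).trans (add_le_add ?_ ?_)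
    · rw [abs_mul]
      calc |χ x| * |J x - J x'| ≤ 1 * |J x - J x'| := mul_le_mul_of_nonneg_right (hχ1 x) (abs_nonneg _)
        _ = |J x - J x'| := one_mul _
    · rw [abs_mul]
      exact mul_le_mul (hχL x x' hq) (abs_le_supNormV1 J x') (abs_nonneg _) (by positivity)
  calc tparV1 hN D x x' ^ (-ε) * |χ x * J x - χ x' * J x'|
      ≤ tparV1 hN D x x' ^ (-ε) * (|J x - J x'| + Λ * tparV1 hN D x x' * supNormV1 J) := mul_le_mul_of_nonneg_left hsplit hpow
    _ = tparV1 hN D x x' ^ (-ε) * |J x - J x'| + tparV1 hN D x x' ^ (-ε) * (Λ * tparV1 hN D x x') * supNormV1 J := by ring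
    _ ≤ holderV1 hN D ε J + Λ * supNormV1 J :=
        add_le_add (le_holderV1 hN D ε J hq) (mul_le_mul_of_nonneg_right (rpow_neg_mul_le ht0 ht1 hε1 hΛ) hS)

/-- `|χJ| ≤ |J|` for `|χ| ≤ 1`. [cite: Balaban1984PropagatorsII, p.231, bookkeeping] -/
theorem supNormV1_mulOp_le {χ : PBond (PV d ℓ m K hd hL) 0 → ℝ} (hχ1 : ∀ x, |χ x| ≤ 1) (J : PBond (PV d ℓ m K hd hL) 0 → ℝ) :
    supNormV1 (mulOp χ J) ≤ supNormV1 J := by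
  refine supNormV1_le (supNormV1_nonneg J) fun x => ?_
  rw [mulOp_apply, abs_mul]
  calc |χ x| * |J x| ≤ 1 * |J x| := mul_le_mul_of_nonneg_right (hχ1 x) (abs_nonneg _)
    _ = |J x| := one_mul _
    _ ≤ supNormV1 J := abs_le_supNormV1 J x

/-- **THE CLASS MAP OF A MULTIPLIER**: `mulOp χ` (`|χ| ≤ 1`, `Λ`-Lipschitz at the block scale on admissible pairs) carries the admissible inputs at `y′`
of size `B` into admissible inputs at `y′` of size `(1 + Λ)B` — the hypothesis `hE` of `…B6RandomWalkInputNorm.hasMajorantA_mul_of_mapsTo` for the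
input `(S_νh_□)J` of the legs of (2.141). [cite: Balaban1984PropagatorsII, (2.138)/(2.141) p.247; derivation ours] -/
theorem normSupp_mulOp {ε : ℝ} (hε1 : ε ≤ 1) {χ : PBond (PV d ℓ m K hd hL) 0 → ℝ} {Λ : ℝ} (hΛ : 0 ≤ Λ)
    (hχ1 : ∀ x, |χ x| ≤ 1) (hχL : ∀ x x', AdmV1 hN D x x' → |χ x - χ x'| ≤ Λ * tparV1 hN D x x')
    {J : PBond (PV d ℓ m K hd hL) 0 → ℝ} {y' : (geomT D).Site} {B : ℝ}
    (h : NormSupp (g := geomT D) (blkV1 hN D) (fun y' => ({y'} : Set (geomT D).Site)) (fun _ J => holderV1 hN D ε J + supNormV1 J) J y' B) :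
    NormSupp (g := geomT D) (blkV1 hN D) (fun y' => ({y'} : Set (geomT D).Site)) (fun _ J => holderV1 hN D ε J + supNormV1 J)
      (mulOp χ J) y' ((1 + Λ) * B) := by
  have hB := h.nonneg
  have hS := supNormV1_nonneg J
  have hH := holderV1_nonneg hN D ε J
  refine ⟨by positivity, ?_, fun x hx => by rw [mulOp_apply, h.off x hx, mul_zero]⟩
  have hb : holderV1 hN D ε J + supNormV1 J ≤ B := h.bound
  calc holderV1 hN D ε (mulOp χ J) + supNormV1 (mulOp χ J)
      ≤ (holderV1 hN D ε J + Λ * supNormV1 J) + supNormV1 J :=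
        add_le_add (holderV1_mulOp_le hε1 hΛ hχ1 hχL J) (supNormV1_mulOp_le hχ1 J)
    _ ≤ (1 + Λ) * (holderV1 hN D ε J + supNormV1 J) := by nlinarith [mul_nonneg hΛ hH]
    _ ≤ (1 + Λ) * B := mul_le_mul_of_nonneg_left hb (by positivity)

end Mul

end Literature.MathematicalPhysics.QuantumFieldTheory.Balaban1983to89.B6HolderNormV1

end
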